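import Mathlib
import Summits.ResolutionOfSingularities.ResolutionOfSingularities.Theorems.WildQuotientsWildQuotientResolutionTwoBlocksCentreStable

/-!
# Rung V3 (one blow-up model): the ideal `K₃ = (x_a⁴, x_a³x_b, x_a²x_b³, x_a x_b⁴, x_b⁶)` is `⟨J₃⟩`-stable

(crux stmt-ResolutionOfSingularities-15640 `WildQuotients.WildQuotientResolution`, line `Sketch`,
sector `|G| = p`; rung V3 of `L/w45c/CHAIN.md` v4, ONE-BLOW-UP design of record (lead-1 RULING
2026-08-27T01:07:58Z, `L/res-L1-w45c-lead-1/V3-K3-DESIGN.md`; stub-4 PROPOSAL V3-ONE-BLOWUP):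
the three-step plain tower resolving `𝔸ⁿ/⟨J₃⟩` in characteristic `3` is the single blow-up of
`𝔸ⁿ` along the complete monomial ideal
`K₃ = (x_a,x_b)·(x_a,x_b²)·(x_a²,x_a x_b²,x_b³) = (x_a⁴, x_a³x_b, x_a²x_b³, x_a x_b⁴, x_b⁶)`
`= {x_a^i x_b^j : i+j ≥ 4, 2i+j ≥ 6, 3i+2j ≥ 11}`. [OURS · L1 W4.5c] — NOT a statement of any
manuscript; replaces the role of no printed item. Prover res-L1-w45c-stub-4, part (a) of the split.)

GENERATOR VECTOR OF RECORD (literal, shared with stub-2's chart files and lead-1's assembly):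
`(![X a ^ 4, X a ^ 3 * X b, X a ^ 2 * X b ^ 3, X a * X b ^ 4, X b ^ 6] : Fin 5 → MvPolynomial (Fin n) k)`.

* `map_k3_le` — for ANY ring endomorphism `τ` with `τ x_a = x_a`, `τ x_b = x_b + s·x_a`
  (`s` arbitrary), `τ(K₃) ⊆ K₃` (explicit `K₃`-combinations of the five `τ`-images; no hypothesis
  on the characteristic: every defining weight functional of `K₃` weighs `x_a ≥ x_b`).
* `map_k3_eq` — hence `σ(K₃) = K₃` for the `J₃` datum (apply `map_k3_le` to `σ` with `s = 1` and
  to `σ⁻¹` with `s = −1`).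
* `smul_k3_eq` — `g • K₃ = K₃` for every `g ∈ ⟨σ⟩` (the hypothesis of
  `AffineQuotient.idealSheaf_comap_specAction`).
* `idealSheaf_k3_comap` — VERBATIM the hypothesis `hρ` of `IsBlowup.liftAction` for the blow-up
  of `𝔸ⁿ` along `K₃` and any action `ρ` of `⟨σ⟩` with the affine-quotient law `ρ g = Spec (g⁻¹)`
  (pattern `JordanThree.idealSheaf_centre_comap`, p480661).
-/

-- single-problem summit: the doubled namespace component `ResolutionOfSingularities` is forced
set_option linter.dupNamespace false

noncomputable section

open CategoryTheory AlgebraicGeometry MvPolynomial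
open scoped Pointwise
open Literature.AlgebraicGeometry.Resolution

namespace Summit.ResolutionOfSingularities.ResolutionOfSingularities.Theorems.WildQuotientResolution.JordanThree

/-- **`τ(K₃) ⊆ K₃`** for every ring endomorphism `τ` of `k[x₁,…,xₙ]` with `τ x_a = x_a` and
`τ x_b = x_b + s·x_a`: the images of the five generators are the explicit `K₃`-combinations
`x_a⁴`, `x_a³x_b + s·x_a⁴`, `x_a²x_b³ + 3s x_b·x_a³x_b + (3s²x_b + s³x_a)·x_a⁴`,
`x_a x_b⁴ + 4s·x_a²x_b³ + 6s²x_b·x_a³x_b + (4s³x_b + s⁴x_a)·x_a⁴`,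
`x_b⁶ + 6s x_b·x_a x_b⁴ + 15s²x_b·x_a²x_b³ + 20s³x_b²·x_a³x_b + (15s⁴x_b² + 6s⁵x_a x_b + s⁶x_a²)·x_a⁴`.
[folklore; `K₃` is cut out by monomial valuations weighing `x_a ≥ x_b`] -/
theorem map_k3_le (k : Type) [Field k] (n : ℕ) (a b : Fin n)
    (τ : MvPolynomial (Fin n) k →+* MvPolynomial (Fin n) k) (s : MvPolynomial (Fin n) k)
    (ha : τ (X a) = X a) (hb : τ (X b) = X b + s * X a) :
    Ideal.map τ (Ideal.span (Set.range
      (![X a ^ 4, X a ^ 3 * X b, X a ^ 2 * X b ^ 3, X a * X b ^ 4, X b ^ 6] :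
        Fin 5 → MvPolynomial (Fin n) k))) ≤
      Ideal.span (Set.range
        (![X a ^ 4, X a ^ 3 * X b, X a ^ 2 * X b ^ 3, X a * X b ^ 4, X b ^ 6] :
          Fin 5 → MvPolynomial (Fin n) k)) := by
  rw [Ideal.map_span, Ideal.span_le]
  rintro _ ⟨_, ⟨j, rfl⟩, rfl⟩
  rw [SetLike.mem_coe, Ideal.mem_span_range_iff_exists_fun]
  fin_cases j
  · refine ⟨![1, 0, 0, 0, 0], ?_⟩
    simp only [Fin.sum_univ_five, Matrix.cons_val_zero, Matrix.cons_val_one, Matrix.cons_val_two,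
      Matrix.cons_val_three, Matrix.cons_val_four, Matrix.head_cons, Matrix.tail_cons,
      Fin.zero_eta, map_pow, ha]
    ring
  · refine ⟨![s, 1, 0, 0, 0], ?_⟩
    simp only [Fin.sum_univ_five, Matrix.cons_val_zero, Matrix.cons_val_one, Matrix.cons_val_two,
      Matrix.cons_val_three, Matrix.cons_val_four, Matrix.head_cons, Matrix.tail_cons,
      Fin.mk_one, map_pow, map_mul, ha, hb]
    ring
  · refine ⟨![3 * s ^ 2 * X b + s ^ 3 * X a, 3 * s * X b, 1, 0, 0], ?_⟩
    simp only [Fin.sum_univ_five, Matrix.cons_val_zero, Matrix.cons_val_one, Matrix.cons_val_two,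
      Matrix.cons_val_three, Matrix.cons_val_four, Matrix.head_cons, Matrix.tail_cons,
      Fin.reduceFinMk, map_pow, map_mul, ha, hb]
    ring
  · refine ⟨![4 * s ^ 3 * X b + s ^ 4 * X a, 6 * s ^ 2 * X b, 4 * s, 1, 0], ?_⟩
    simp only [Fin.sum_univ_five, Matrix.cons_val_zero, Matrix.cons_val_one, Matrix.cons_val_two,
      Matrix.cons_val_three, Matrix.cons_val_four, Matrix.head_cons, Matrix.tail_cons,
      Fin.reduceFinMk, map_pow, map_mul, ha, hb]
    ring
  · refine ⟨![15 * s ^ 4 * X b ^ 2 + 6 * s ^ 5 * X a * X b + s ^ 6 * X a ^ 2, 20 * s ^ 3 * X b ^ 2,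
      15 * s ^ 2 * X b, 6 * s * X b, 1], ?_⟩
    simp only [Fin.sum_univ_five, Matrix.cons_val_zero, Matrix.cons_val_one, Matrix.cons_val_two,
      Matrix.cons_val_three, Matrix.cons_val_four, Matrix.head_cons, Matrix.tail_cons,
      Fin.reduceFinMk, map_pow, hb]
    ring

/-- **`σ(K₃) = K₃`** for the `J₃` datum `σ x_a = x_a`, `σ x_b = x_b + x_a` (`map_k3_le` for `σ`
with `s = 1` and for `σ⁻¹` with `s = −1`, and `K₃ = σ(σ⁻¹(K₃)) ⊆ σ(K₃)`). [folklore] -/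
theorem map_k3_eq (k : Type) [Field k] (n : ℕ)
    (σ : MvPolynomial (Fin n) k ≃ₐ[k] MvPolynomial (Fin n) k) (a b : Fin n)
    (ha : σ (X a) = X a) (hb : σ (X b) = X b + X a) :
    Ideal.map (σ : MvPolynomial (Fin n) k →+* MvPolynomial (Fin n) k) (Ideal.span (Set.range
      (![X a ^ 4, X a ^ 3 * X b, X a ^ 2 * X b ^ 3, X a * X b ^ 4, X b ^ 6] :
        Fin 5 → MvPolynomial (Fin n) k))) =
      Ideal.span (Set.range
        (![X a ^ 4, X a ^ 3 * X b, X a ^ 2 * X b ^ 3, X a * X b ^ 4, X b ^ 6] :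
          Fin 5 → MvPolynomial (Fin n) k)) := by
  apply le_antisymm
  · exact map_k3_le k n a b (σ : MvPolynomial (Fin n) k →+* MvPolynomial (Fin n) k) 1
      (by simpa only [RingHom.coe_coe] using ha) (by simpa only [RingHom.coe_coe, one_mul] using hb)
  · -- `σ⁻¹ x_a = x_a`, `σ⁻¹ x_b = x_b − x_a`
    have ha' : σ.symm (X a) = X a := by
      conv_lhs => rw [← ha]
      exact σ.symm_apply_apply _
    have hb' : σ.symm (X b) = X b + (-1) * X a := by
      have h := σ.symm_apply_apply (X b)
      rw [hb, map_add, ha'] at h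
      linear_combination h
    have hle := map_k3_le k n a b (σ.symm : MvPolynomial (Fin n) k →+* MvPolynomial (Fin n) k)
      (-1) (by simpa only [RingHom.coe_coe] using ha') (by simpa only [RingHom.coe_coe] using hb')
    have hcomp : (σ : MvPolynomial (Fin n) k →+* MvPolynomial (Fin n) k).comp
        (σ.symm : MvPolynomial (Fin n) k →+* MvPolynomial (Fin n) k) = RingHom.id _ := by
      ext x <;> simp
    calc Ideal.span (Set.range
          (![X a ^ 4, X a ^ 3 * X b, X a ^ 2 * X b ^ 3, X a * X b ^ 4, X b ^ 6] :
            Fin 5 → MvPolynomial (Fin n) k))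
        = Ideal.map ((σ : MvPolynomial (Fin n) k →+* MvPolynomial (Fin n) k).comp
            (σ.symm : MvPolynomial (Fin n) k →+* MvPolynomial (Fin n) k)) (Ideal.span (Set.range
          (![X a ^ 4, X a ^ 3 * X b, X a ^ 2 * X b ^ 3, X a * X b ^ 4, X b ^ 6] :
            Fin 5 → MvPolynomial (Fin n) k))) := by rw [hcomp, Ideal.map_id]
      _ = Ideal.map (σ : MvPolynomial (Fin n) k →+* MvPolynomial (Fin n) k)
            (Ideal.map (σ.symm : MvPolynomial (Fin n) k →+* MvPolynomial (Fin n) k)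
              (Ideal.span (Set.range
                (![X a ^ 4, X a ^ 3 * X b, X a ^ 2 * X b ^ 3, X a * X b ^ 4, X b ^ 6] :
                  Fin 5 → MvPolynomial (Fin n) k)))) := by rw [Ideal.map_map]
      _ ≤ _ := Ideal.map_mono hle

/-- **`K₃` is `⟨σ⟩`-stable**: `g • K₃ = K₃` for every `g ∈ ⟨σ⟩`, for the `J₃` datum
`σ x_b = x_b + x_a`, `σ x_i = x_i` (`i ≠ b, c`; so `σ x_a = x_a` as `a ≠ b`, `a ≠ c`) — the
hypothesis of `AffineQuotient.idealSheaf_comap_specAction` / `IsBlowup.liftAction` for the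
one-blow-up model. (Pattern `JordanThree.smul_centre_eq`, p480312.) [folklore] -/
theorem smul_k3_eq (k : Type) [Field k] (n : ℕ)
    (σ : MvPolynomial (Fin n) k ≃ₐ[k] MvPolynomial (Fin n) k) (a b c : Fin n)
    (hab : a ≠ b) (hac : a ≠ c) (hb : σ (X b) = X b + X a)
    (hσ : ∀ i, i ≠ b → i ≠ c → σ (X i) = X i) (g : Subgroup.zpowers σ) :
    g • Ideal.span (Set.range
      (![X a ^ 4, X a ^ 3 * X b, X a ^ 2 * X b ^ 3, X a * X b ^ 4, X b ^ 6] :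
        Fin 5 → MvPolynomial (Fin n) k)) =
      Ideal.span (Set.range
        (![X a ^ 4, X a ^ 3 * X b, X a ^ 2 * X b ^ 3, X a * X b ^ 4, X b ^ 6] :
          Fin 5 → MvPolynomial (Fin n) k)) := by
  have ha : σ (X a) = X a := hσ a hab hac
  have hσ' : σ • Ideal.span (Set.range
      (![X a ^ 4, X a ^ 3 * X b, X a ^ 2 * X b ^ 3, X a * X b ^ 4, X b ^ 6] :
        Fin 5 → MvPolynomial (Fin n) k)) =
      Ideal.span (Set.range
        (![X a ^ 4, X a ^ 3 * X b, X a ^ 2 * X b ^ 3, X a * X b ^ 4, X b ^ 6] :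
          Fin 5 → MvPolynomial (Fin n) k)) :=
    map_k3_eq k n σ a b ha hb
  obtain ⟨z, hz⟩ := Subgroup.mem_zpowers_iff.mp g.2
  change (g : MvPolynomial (Fin n) k ≃ₐ[k] MvPolynomial (Fin n) k) • Ideal.span (Set.range
      (![X a ^ 4, X a ^ 3 * X b, X a ^ 2 * X b ^ 3, X a * X b ^ 4, X b ^ 6] :
        Fin 5 → MvPolynomial (Fin n) k)) = _
  rw [← hz]
  exact MulAction.fixedBy_subset_fixedBy_zpow (Ideal (MvPolynomial (Fin n) k)) σ z hσ'

/-- **The ideal sheaf of `K₃` on `𝔸ⁿ` is stable under the action of `⟨σ⟩`** (`ρ g = Spec (g⁻¹)`)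
for the `J₃` datum — VERBATIM the hypothesis `hρ` of `IsBlowup.liftAction` for the one-blow-up
model `Bl_{K₃} 𝔸ⁿ` (pattern `JordanThree.idealSheaf_centre_comap`, p480661). [folklore] -/
theorem idealSheaf_k3_comap (k : Type) [Field k] (n : ℕ)
    (σ : MvPolynomial (Fin n) k ≃ₐ[k] MvPolynomial (Fin n) k) (a b c : Fin n)
    (hab : a ≠ b) (hac : a ≠ c) (hb : σ (X b) = X b + X a)
    (hσ : ∀ i, i ≠ b → i ≠ c → σ (X i) = X i)
    (ρ : ↥(Subgroup.zpowers σ) →* Aut (Spec (CommRingCat.of (MvPolynomial (Fin n) k))))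
    (hρ : ∀ g : ↥(Subgroup.zpowers σ), (ρ g).hom = Spec.map (CommRingCat.ofHom
      ((MulSemiringAction.toRingEquiv (↥(Subgroup.zpowers σ)) (MvPolynomial (Fin n) k) g⁻¹ :
        MvPolynomial (Fin n) k ≃+* MvPolynomial (Fin n) k) :
          MvPolynomial (Fin n) k →+* MvPolynomial (Fin n) k)))
    (g : ↥(Subgroup.zpowers σ)) :
    (affineBlowup.idealSheaf (Ideal.span (Set.range
      (![X a ^ 4, X a ^ 3 * X b, X a ^ 2 * X b ^ 3, X a * X b ^ 4, X b ^ 6] :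
        Fin 5 → MvPolynomial (Fin n) k)))).comap (ρ g).hom =
      affineBlowup.idealSheaf (Ideal.span (Set.range
        (![X a ^ 4, X a ^ 3 * X b, X a ^ 2 * X b ^ 3, X a * X b ^ 4, X b ^ 6] :
          Fin 5 → MvPolynomial (Fin n) k))) :=
  AffineQuotient.idealSheaf_comap_specAction ρ hρ _ (smul_k3_eq k n σ a b c hab hac hb hσ) g

end Summit.ResolutionOfSingularities.ResolutionOfSingularities.Theorems.WildQuotientResolution.JordanThree

end
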